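import Mathlib
import HarnessLib
import Summits.HubbardSuperconductivity.HubbardSuperconductivity.Theorems.KLProgrammeKLRegimeSplitPhValueModuli

/-!
# Route `KLProgramme` — ENGINE (stmt-HubbardSuperconductivity-20437 `KLRegimeEngineV17F2`), row (c) binders #8/#9, the self-energy row `RS` in LOCALISED form, ALL PIECES:
# linear part (O5b, DOS-slope) + constant part (O6c, rotation) + Taylor/tree remainder (O6e, moduli × sign-blind mass) — brick O5c, the closer-side capstone of cure (C′) §2 rows 1–5
# (cell gate-hubbard-kl, seat hubbard-kl-k3c2-p2 g32, technique «thermal-bar induction n ≤ nScales β + 1 with EngineBoundsAtV4S sums»)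

WHY.  Located #22 «(c)-OUT-NEAR-SLICE-LEGS» (C) and its in-class twin: the born/self-energy row `RS = Σ_pΣ_σ(Ẇ_tβL²ĝ_p)(Φ_jβL²ĝ_p)·Y(p,σ)`, `Y = V6·Sg`, charged generically
is n-flat; cure (C′) (`HOME/hubbard-kl-k3c2-p2/g30/CURE-C-PRIME-DESIGN.md` §1–§2) LOCALISES the self-energy: `Y(p,σ) = T σ·(Sg₀ + zω·iω_p + ze·e_p) + remainder(p,σ)`
((Σλ1): one-shot residual local part `Sg₀`, wave-function/velocity renormalisation `zω, ze`, second-order Taylor remainder; (Σλ2): tree/remainder split of `V6`).  The three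
landed bricks bound the three pieces: O5b `klok_localisedBorn_row_le` (linear part → Matsubara parity → odd momentum sum → two-sided shell asymmetry = DOS-SLOPE size), O6c
`klph_phValue_row_le` (constant part = the rotation lemma: thermal + DOS + lattice), O6e `klph_phValue_row_le_of_moduli` (remainder through its sup `δ` on the hard shell ×
the sign-blind born mass `2¹⁰·15367`).  This file is their SUM:

* **`klok_localisedBorn_row_full_le`** — for ANY `Y : FreqMomentum → Fin 2 → ℂ` and data `(T, Sg₀, zω, ze, δ)` with `‖Y p σ − T σ·(Sg₀ + zω·iω_p + ze·e_p)‖ ≤ δ` wherever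
  `Ẇ_t(p) ≠ 0`, under the C4a chart hypotheses (`Λ(t) + (4+2A)·2π/L < r`), `βΛ(t)/(2π) + 1 ≤ M`, `FrameOK R U N μ K`, `klBetaMin ≤ β ≤ L`, `j ≥ n+1`, `t ∈ [0,1]`:
  `(Λₙ−Λₙ₊₁)((βL²)³)⁻¹‖Σ_pΣ_σ(Ẇ_tβL²ĝ)(Φ_jβL²ĝ)·Y p σ‖ ≤ [O5b size]·‖Σ_σ T σ‖ + (Λₙ−Λₙ₊₁)·‖Σ_σ T σ·Sg₀‖·𝔅₆_b + 2¹⁰·15367·δ`.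
So the E1 owner's (Σλ1)/(Σλ2) rows enter the closer ONLY as the five numbers `‖ΣT‖, ‖ΣT·Sg₀‖, ‖2zω+ze‖, ‖zω+ze‖, δ`; by value (CURE-C-PRIME-DESIGN §2, LOCALISED-ROW-BY-VALUE.md)
every term is `frameShiftBar`/`thermalBar`/volume-share sized.  Pure composition; no definitions; nothing asserts (c), K3 or superconductivity.
[cite: BenfattoGiulianiMastropietro2006, §2.9]
-/

noncomputable section

namespace Summit.HubbardSuperconductivity.HubbardSuperconductivity.Theorems.KLRegimeSplit

set_option linter.dupNamespace false -- summit = problem name (single-conjunct summit), D-0017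

open Real Set Finset Literature.MathematicalPhysics.QuantumLattice
open Literature.Probability.LatticeModels hiding torusSupNorm
open Literature.MathematicalPhysics.QuantumLattice.BandSectorCounting
open Summit.HubbardSuperconductivity.HubbardSuperconductivity.Theorems.TwoPointAssembly
open Summit.HubbardSuperconductivity.HubbardSuperconductivity.Theorems.KLProgrammeLegKernels
open Summit.HubbardSuperconductivity.HubbardSuperconductivity.Theorems.KLRegimeWick
open Summit.HubbardSuperconductivity.HubbardSuperconductivity.Theorems.EngineV8
open Summit.HubbardSuperconductivity.HubbardSuperconductivity.Theorems.DispersionFlow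
open Summit.HubbardSuperconductivity.HubbardSuperconductivity.Theorems.PerturbedFermiCurve

variable {L M : ℕ} [NeZero L] [NeZero M]

/-! ## The RS row in LOCALISED form: linear part (O5b) + constant part (rotation, O6c) + Taylor/tree remainder (moduli) -/

section Localised

variable {R : RenConsts} {U : ℝ} {N : ℕ}

/-- **THE LOCALISED SELF-ENERGY ROW, ALL PIECES (cure (C′) §2 rows 1–5, closer side).**  Let the self-energy line inside the born row be ANY
`Y : FreqMomentum → Fin 2 → ℂ` with localisation data `(T, Sg₀, zω, ze)` and a remainder modulus `δ ≥ 0` on the hard shell: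
`‖Y p σ − T σ·(Sg₀ + zω·iω_p + ze·e_p)‖ ≤ δ` whenever `Ẇ_t(p) ≠ 0` ((Σλ1)/(Σλ2): `δ` carries `T·SgR` and `V6R·Sg`).  Then, under the C4a chart hypotheses
(`Λ(t) + (4+2A)·2π/L < r`), `βΛ(t)/(2π) + 1 ≤ M`, an admissible frame `FrameOK R U N μ K`, `klBetaMin ≤ β ≤ L`, member `j ≥ n+1`, `t ∈ [0,1]`:
`(Λₙ−Λₙ₊₁)((βL²)³)⁻¹‖Σ_pΣ_σ(Ẇ_tβL²ĝ)(Φ_jβL²ĝ)·Y p σ‖ ≤ [O5b: DOS-slope size × ‖Σ_σT σ‖] + [O6c: rotation size × ‖Σ_σ T σ·Sg₀‖] + 2¹⁰·15367·δ`.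
[cite: BenfattoGiulianiMastropietro2006, §2.9] -/
theorem klok_localisedBorn_row_full_le {β μ : ℝ} {K : TrigPolyC4v} (hK : FrameOK R U N μ K) (hβ : klBetaMin ≤ β) (hβL : β ≤ L)
    {a b : ℝ} (B : BandBounds a b) {A : ℝ} (hA : ∀ p : Momentum, ∀ j ≤ 2, ‖iteratedFDeriv ℝ j (frameShift K) p‖ ≤ A) (hADt : 2 * A < B.Dtmin)
    {r : ℝ} (hlo : a < μ - r - A) (hhi : μ + r + A < b) (n : ℕ) {t : ℝ} (ht : t ∈ Icc (0 : ℝ) 1)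
    (Φ : ℕ → ℝ → FreqMomentum L M → ℝ) (hΦ : Φ = fun j t k => (softSymbolCompl L M β μ K (n + 1) j) k + (hubbardCutoffWeightCT L M β μ K (klScale klE0 (n + 1)) k -
            hubbardCutoffWeightCT L M β μ K (klScale klE0 n + t * (klScale klE0 (n + 1) - klScale klE0 n)) k))
    (Wd : ℝ → FreqMomentum L M → ℝ) (hWd : Wd = fun t k => deriv (fun Λ' : ℝ => hubbardCutoffWeightCT L M β μ K Λ' k) (klScale klE0 n + t * (klScale klE0 (n + 1) - klScale klE0 n)))
    {j : ℕ} (hj : n + 1 ≤ j) (hΛr : klScale klE0 n + t * (klScale klE0 (n + 1) - klScale klE0 n) + (4 + 2 * A) * (2 * π / L) < r)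
    (hM : β * (klScale klE0 n + t * (klScale klE0 (n + 1) - klScale klE0 n)) / (2 * Real.pi) + 1 ≤ M)
    {Mg ℓ r₁ : ℝ} (hr₁ : 0 < r₁)
    (hbd : ∀ s, |klWd (klScale klE0 n + t * (klScale klE0 (n + 1) - klScale klE0 n)) s *
      klPhi (klScale klE0 j) (klScale klE0 n + t * (klScale klE0 (n + 1) - klScale klE0 n)) s| ≤ Mg)
    (hlip : ∀ s s', |klWd (klScale klE0 n + t * (klScale klE0 (n + 1) - klScale klE0 n)) s *
        klPhi (klScale klE0 j) (klScale klE0 n + t * (klScale klE0 (n + 1) - klScale klE0 n)) s -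
      klWd (klScale klE0 n + t * (klScale klE0 (n + 1) - klScale klE0 n)) s' *
        klPhi (klScale klE0 j) (klScale klE0 n + t * (klScale klE0 (n + 1) - klScale klE0 n)) s'| ≤ ℓ * |s - s'|)
    (hin : ∀ s, s ≤ r₁ ^ 2 → klWd (klScale klE0 n + t * (klScale klE0 (n + 1) - klScale klE0 n)) s *
      klPhi (klScale klE0 j) (klScale klE0 n + t * (klScale klE0 (n + 1) - klScale klE0 n)) s = 0)
    (hout : ∀ s, (klScale klE0 n + t * (klScale klE0 (n + 1) - klScale klE0 n)) ^ 2 ≤ s →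
      klWd (klScale klE0 n + t * (klScale klE0 (n + 1) - klScale klE0 n)) s *
        klPhi (klScale klE0 j) (klScale klE0 n + t * (klScale klE0 (n + 1) - klScale klE0 n)) s = 0)
    (Y : FreqMomentum L M → Fin 2 → ℂ) (T : Fin 2 → ℂ) (Sg₀ zω ze : ℂ) {δ : ℝ} (hδ0 : 0 ≤ δ)
    (hδ : ∀ p : FreqMomentum L M, ∀ σ : Fin 2, Wd t p ≠ 0 →
      ‖Y p σ - T σ * (Sg₀ + zω * (Complex.I * (matsubaraFreq β M p.1 : ℂ)) + ze * (nambuXiCT L μ K p.2 : ℂ))‖ ≤ δ) :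
    (klScale klE0 n - klScale klE0 (n + 1)) * ((β * (L : ℝ) ^ 2) ^ 3)⁻¹ *
      ‖∑ p : FreqMomentum L M, ∑ σ : Fin 2,
        (((((Wd t p) : ℝ) : ℂ) * (((β * (L : ℝ) ^ 2 : ℝ) : ℂ) * propCT L M β μ K p)) * ((((Φ j t p) : ℝ) : ℂ) * (((β * (L : ℝ) ^ 2 : ℝ) : ℂ) * propCT L M β μ K p))) *
          Y p σ‖ ≤
      (klScale klE0 n - klScale klE0 (n + 1)) / (β * (L : ℝ) ^ 2) * ‖∑ σ : Fin 2, T σ‖ *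
        ((‖2 * zω + ze‖ * (((klScale klE0 n + t * (klScale klE0 (n + 1) - klScale klE0 n)) * β / π + 1) * (Mg / r₁ ^ 2) +
            2 * (klScale klE0 n + t * (klScale klE0 (n + 1) - klScale klE0 n)) *
              (((klScale klE0 n + t * (klScale klE0 (n + 1) - klScale klE0 n)) * β / π + 1) * (ℓ / r₁ ^ 2 + Mg / r₁ ^ 4)) *
              (2 * (2 * (klScale klE0 n + t * (klScale klE0 (n + 1) - klScale klE0 n))))) +
          2 * ‖zω + ze‖ * (3 * (2 * (klScale klE0 n + t * (klScale klE0 (n + 1) - klScale klE0 n))) ^ 2 *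
              (((klScale klE0 n + t * (klScale klE0 (n + 1) - klScale klE0 n)) * β / π + 1) * (Mg / r₁ ^ 4)) +
            (2 * (klScale klE0 n + t * (klScale klE0 (n + 1) - klScale klE0 n))) ^ 3 *
              (((klScale klE0 n + t * (klScale klE0 (n + 1) - klScale klE0 n)) * β / π + 1) * (ℓ / r₁ ^ 4 + 2 * Mg / r₁ ^ 6)) *
              (2 * (2 * (klScale klE0 n + t * (klScale klE0 (n + 1) - klScale klE0 n)))))) *
        ((klScale klE0 n + t * (klScale klE0 (n + 1) - klScale klE0 n)) * (((L : ℝ) / (2 * π)) ^ 2 *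
          (4 * π * (1 / (B.Dtmin - 2 * A) ^ 2 + Real.pi * Real.sqrt 2 * (2 + 4 * A) / (B.Dtmin - 2 * A) ^ 3) *
              (klScale klE0 n + t * (klScale klE0 (n + 1) - klScale klE0 n)) ^ 2 +
            4 * (2 * π * (π * Real.sqrt 2 / (B.Dtmin - 2 * A))) * ((4 + 2 * A) * (2 * π / L)))))) +
      ((klScale klE0 n - klScale klE0 (n + 1)) * ‖∑ σ : Fin 2, T σ * Sg₀‖ *
        (((2 * π) ^ 2)⁻¹ * (2 * π * (π * Real.sqrt 2 / (B.Dtmin - 2 * A)) *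
              ((2 * (klScale klE0 n + t * (klScale klE0 (n + 1) - klScale klE0 n)) * (2 * (klScale klE0 n + t * (klScale klE0 (n + 1) - klScale klE0 n)) *
                (2 * (klScale klE0 n + t * (klScale klE0 (n + 1) - klScale klE0 n)) ^ 2 * (ℓ / r₁ ^ 4 + 2 * Mg / r₁ ^ 6) + (ℓ / r₁ ^ 2 + Mg / r₁ ^ 4)))) *
                ((klScale klE0 n + t * (klScale klE0 (n + 1) - klScale klE0 n)) + 2 * Real.pi / β) / β) +
            β⁻¹ * (((klScale klE0 n + t * (klScale klE0 (n + 1) - klScale klE0 n)) * β / π + 1) *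
              (2 * (klScale klE0 n + t * (klScale klE0 (n + 1) - klScale klE0 n)) *
                (2 * π * (1 / (B.Dtmin - 2 * A) ^ 2 + Real.pi * Real.sqrt 2 * (2 + 4 * A) / (B.Dtmin - 2 * A) ^ 3) *
                  (klScale klE0 n + t * (klScale klE0 (n + 1) - klScale klE0 n)) * (Mg / r₁ ^ 2))))) +
          ((klScale klE0 n + t * (klScale klE0 (n + 1) - klScale klE0 n)) / π + 3 / β) *
            (2 * π * (2 * (klScale klE0 n + t * (klScale klE0 (n + 1) - klScale klE0 n)) *
              (2 * (klScale klE0 n + t * (klScale klE0 (n + 1) - klScale klE0 n)) ^ 2 * (ℓ / r₁ ^ 4 + 2 * Mg / r₁ ^ 6) + (ℓ / r₁ ^ 2 + Mg / r₁ ^ 4)) *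
              (4 + 2 * A)) / L)) +
        (2 : ℝ) ^ 10 * 15367 * δ) := by
  have hβ0 : 0 < β := pos_of_klBetaMin_le hβ
  have hL : (0 : ℝ) < L := hβ0.trans_le hβL
  have hΛr' : klScale klE0 n + t * (klScale klE0 (n + 1) - klScale klE0 n) < r := by
    have : 0 ≤ (4 + 2 * A) * (2 * π / L) := by
      have hA0 : 0 ≤ A := le_trans (norm_nonneg _) (hA 0 0 (by norm_num))
      positivity
    linarith
  -- abbreviations
  set line : FreqMomentum L M → ℂ := fun p =>
    ((((Wd t p) : ℝ) : ℂ) * (((β * (L : ℝ) ^ 2 : ℝ) : ℂ) * propCT L M β μ K p)) * ((((Φ j t p) : ℝ) : ℂ) * (((β * (L : ℝ) ^ 2 : ℝ) : ℂ) * propCT L M β μ K p))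
    with hline_def
  set Wrem : FreqMomentum L M → Fin 2 → ℂ := fun p σ =>
    Y p σ - T σ * (zω * (Complex.I * (matsubaraFreq β M p.1 : ℂ)) + ze * (nambuXiCT L μ K p.2 : ℂ)) with hWrem_def
  -- the split `Y = T·(zω iω + ze e) + Wrem`
  have hsplit : ∑ p : FreqMomentum L M, ∑ σ : Fin 2, line p * Y p σ =
      (∑ p : FreqMomentum L M, ∑ σ : Fin 2, line p * (T σ * (zω * (Complex.I * (matsubaraFreq β M p.1 : ℂ)) + ze * (nambuXiCT L μ K p.2 : ℂ)))) +
        ∑ p : FreqMomentum L M, ∑ σ : Fin 2, line p * Wrem p σ := by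
    rw [← sum_add_distrib]
    refine sum_congr rfl fun p _ => ?_
    rw [← sum_add_distrib]
    refine sum_congr rfl fun σ _ => ?_
    simp only [hWrem_def]
    ring
  have hrem : ∀ p : FreqMomentum L M, ∀ σ : Fin 2, Wd t p ≠ 0 → ‖Wrem p σ - T σ * Sg₀‖ ≤ δ := by
    intro p σ hp
    have h := hδ p σ hp
    have : Wrem p σ - T σ * Sg₀ = Y p σ - T σ * (Sg₀ + zω * (Complex.I * (matsubaraFreq β M p.1 : ℂ)) + ze * (nambuXiCT L μ K p.2 : ℂ)) := by
      simp only [hWrem_def]; ring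
    rw [this]; exact h
  have hlin := klok_localisedBorn_row_le (L := L) (M := M) hβ0 μ B hA hADt hlo hhi n ht Φ hΦ Wd hWd j hΛr hr₁ hbd hlip hin hout T zω ze
  have hmod := klph_phValue_row_le_of_moduli (L := L) (M := M) hK hβ hβL B hA hADt hlo hhi n ht Φ hΦ Wd hWd hj hΛr' hM hr₁ hbd hlip hin hout
    Wrem (fun σ => T σ * Sg₀) hδ0 hrem
  have hC : 0 ≤ (klScale klE0 n - klScale klE0 (n + 1)) * ((β * (L : ℝ) ^ 2) ^ 3)⁻¹ := by
    have h10 := (klmf_klScale_succ_pos_le n).2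
    have : 0 ≤ klScale klE0 n - klScale klE0 (n + 1) := by linarith
    positivity
  calc (klScale klE0 n - klScale klE0 (n + 1)) * ((β * (L : ℝ) ^ 2) ^ 3)⁻¹ * ‖∑ p : FreqMomentum L M, ∑ σ : Fin 2, line p * Y p σ‖
      = (klScale klE0 n - klScale klE0 (n + 1)) * ((β * (L : ℝ) ^ 2) ^ 3)⁻¹ *
          ‖(∑ p : FreqMomentum L M, ∑ σ : Fin 2, line p * (T σ * (zω * (Complex.I * (matsubaraFreq β M p.1 : ℂ)) + ze * (nambuXiCT L μ K p.2 : ℂ)))) +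
            ∑ p : FreqMomentum L M, ∑ σ : Fin 2, line p * Wrem p σ‖ := by rw [hsplit]
    _ ≤ (klScale klE0 n - klScale klE0 (n + 1)) * ((β * (L : ℝ) ^ 2) ^ 3)⁻¹ *
          (‖∑ p : FreqMomentum L M, ∑ σ : Fin 2, line p * (T σ * (zω * (Complex.I * (matsubaraFreq β M p.1 : ℂ)) + ze * (nambuXiCT L μ K p.2 : ℂ)))‖ +
            ‖∑ p : FreqMomentum L M, ∑ σ : Fin 2, line p * Wrem p σ‖) := mul_le_mul_of_nonneg_left (norm_add_le _ _) hC
    _ = (klScale klE0 n - klScale klE0 (n + 1)) * ((β * (L : ℝ) ^ 2) ^ 3)⁻¹ *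
          ‖∑ p : FreqMomentum L M, ∑ σ : Fin 2, line p * (T σ * (zω * (Complex.I * (matsubaraFreq β M p.1 : ℂ)) + ze * (nambuXiCT L μ K p.2 : ℂ)))‖ +
        (klScale klE0 n - klScale klE0 (n + 1)) * ((β * (L : ℝ) ^ 2) ^ 3)⁻¹ * ‖∑ p : FreqMomentum L M, ∑ σ : Fin 2, line p * Wrem p σ‖ := by ring
    _ ≤ _ := add_le_add hlin hmod

end Localised

end Summit.HubbardSuperconductivity.HubbardSuperconductivity.Theorems.KLRegimeSplit

end
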